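import Literature.AlgebraicGeometry.Morphisms.CechModuleUnit
import Literature.AlgebraicGeometry.Modules.RestrictOpenCoh
import HarnessLib

/-!
# Čech `H¹` transport along an open immersion (degree one): `N|_Z` on `𝒯` versus `N` on `φ(𝒯)`

Topic: `Literature/AlgebraicGeometry/Morphisms`. PROVED, fact-free, definition-free. Plumbing for step S6 of
the F-53 route (δ) «domination + divisorial twist» (D-0154 (2) RES inputs cell, seats res-inputs-p-9b /
res-inputs-p-9c): the local Serre-vanishing lemma (`Resolution/BlowupSerreVanishingLocal.lean`) proves
`Ȟ¹ = 0` on the blowing up `Z = Bl_{J(U)}(Spec Γ(X,U))` of an affine open and must read it on `S′ ⊇ φ(Z) = r⁻¹U`.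

THE MATHEMATICS (Stacks 01ED, §20.9 «Čech cohomology and pushforward»; Hartshorne III Lemma 4.4 / Thm. 4.5;
Görtz–Wedhorn II Lemma 21.65). Let `φ : Z → S′` be an open immersion, `N` an `𝒪_{S′}`-module, `𝒯 = (T_t)_t` a
family of opens of `Z`. Mathlib's restriction `N|_Z = N.restrict φ` has sections `Γ(W, N|_Z) = Γ(φW, N)`, so
the Čech complexes of `N|_Z` on `𝒯` and of `N` on `φ(𝒯) = (φ T_t)_t` have the same cochain groups and
differentials; formally: `φ⁻¹(φ𝒯) = 𝒯` (`preimageFamily`), `Č(φ𝒯; φ_*(N|_Z)) = Č(𝒯; N|_Z)` (tree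
`cechMC1PushforwardEquiv`), and the unit `N ⟶ φ_*(N|_Z)` is bijective on every open inside `φ(Z)` (it is the
restriction along `φ(φ⁻¹W) = W`). The module structures over a base ring (`Z → Spec B`, `S′ → Spec A`) do
not enter the conditions `Ž¹ ≤ B̌¹`.

## Main statements

* `cechMZ1_le_cechMB1_of_app_bijective` — degree-one transfer along a morphism of modules `M ⟶ P` bijective
  on the members `T_i` and injective on the `T_i ∩ T_j`: `Ž¹ ≤ B̌¹` for `P` implies it for `M`.
* `cechMZ1_le_cechMB1_iff_of_structureMap` — `Ž¹ ≤ B̌¹` does not depend on the structure map to `Spec A`.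
* `subsingleton_cechMH1_iff_cechMZ1_le_cechMB1` — `Ȟ¹(𝒯; M) = 0 ↔ Ž¹ ≤ B̌¹`.
* `restrictAdjunction_unit_app_bijective` — the unit `N ⟶ φ_*(N|_Z)` is bijective over opens `W ⊆ φ(Z)`.
* `cechMZ1_le_cechMB1_image_of_restrict`, `cechMZ1_le_cechMB1_image_of_subsingleton_restrict` — **if every
  Čech `1`-cocycle of `N|_Z` on `𝒯` is a coboundary (any structure map `Z → Spec B`), then every Čech
  `1`-cocycle of `N` on `(φ T_t)_t` is a coboundary (any structure map `S′ → Spec A`).**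

No step of any summit is discharged here. AI-written; AI review is weaker than expert review.

## References
* The Stacks Project, Tag 01ED (Cohomology, Section 20.9: Čech cohomology and pushforward along a morphism),
  Tag 01R2 (open immersions, restriction of modules). [StacksProject]
* R. Hartshorne, *Algebraic Geometry* (1977), III Lemma 4.4 and Thm. 4.5 (pp. 220–222). [Hartshorne1977]
* U. Görtz, T. Wedhorn, *Algebraic Geometry II* (2023), Lemma 21.65 (p. 259). [GortzWedhorn2023]
-/

noncomputable section

universe u

open CategoryTheory AlgebraicGeometry TopologicalSpace Opposite
open Literature.AlgebraicGeometry.Modules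

namespace Literature.AlgebraicGeometry.Morphisms

section CechTransfer

variable {A' : Type u} [CommRing A'] {Y : Scheme.{u}} (f : Y ⟶ Spec (.of A')) {M P : Y.Modules}
  (φ : M ⟶ P) {κ : Type*} (T : κ → Y.Opens)

/-- **Degree-one Čech transfer along a morphism bijective on the members and injective on the pairwise
intersections**: if `φ_{T_i}` is bijective and `φ_{T_i ∩ T_j}` injective for all `i, j`, then `Ž¹ ≤ B̌¹` for
`P` on `𝒯` implies `Ž¹ ≤ B̌¹` for `M` on `𝒯` (a `1`-cocycle of `M` maps to a coboundary `d⁰b′` of `P`; lift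
`b′ = φ(b)`; compare on the intersections). [cite: StacksProject, Tag 01ED (Cohomology, Section 20.9)] -/
theorem cechMZ1_le_cechMB1_of_app_bijective (h1 : ∀ i, Function.Bijective (φ.app (T i)))
    (h2 : ∀ i j, Function.Injective (φ.app (T i ⊓ T j)))
    (hP : cechMZ1 f P T ≤ cechMB1 f P T) : cechMZ1 f M T ≤ cechMB1 f M T := by
  intro z hz
  have hz' : cechMapC1 f φ T z ∈ cechMZ1 f P T := by
    rw [mem_cechMZ1_iff] at hz ⊢
    rw [cechMD1_mapC1, hz, map_zero]
  obtain ⟨b', hb'⟩ := (mem_cechMB1_iff f P T _).mp (hP hz')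
  choose b hb using fun i => (h1 i).2 (b' i)
  refine (mem_cechMB1_iff f M T z).mpr ⟨b, ?_⟩
  funext i j
  apply h2 i j
  have hbb : cechMapC0 f φ T b = b' := funext fun i => hb i
  have key := congrFun (congrFun hb' i) j
  rw [← hbb, cechMD0_mapC0, cechMapC1_apply, cechMapC1_apply] at key
  exact key

omit φ in
/-- `Ž¹ ≤ B̌¹` does not depend on the structure map used to make the Čech groups modules over a base ring:
the cochains and differentials are the same additive maps.
[cite: StacksProject, Tag 01ED (Cohomology, Section 20.9)] -/
theorem cechMZ1_le_cechMB1_iff_of_structureMap {A'' : Type u} [CommRing A''] (g : Y ⟶ Spec (.of A''))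
    (N : Y.Modules) : cechMZ1 f N T ≤ cechMB1 f N T ↔ cechMZ1 g N T ≤ cechMB1 g N T := by
  constructor
  · intro h z hz
    have hz1 : cechMD1 g N T z = 0 := (mem_cechMZ1_iff g N T z).mp hz
    have hz2 : (z : CechMC1 f N T) ∈ cechMZ1 f N T := (mem_cechMZ1_iff f N T z).mpr hz1
    obtain ⟨b, hb⟩ := (mem_cechMB1_iff f N T _).mp (h hz2)
    exact (mem_cechMB1_iff g N T z).mpr ⟨b, hb⟩
  · intro h z hz
    have hz1 : cechMD1 f N T z = 0 := (mem_cechMZ1_iff f N T z).mp hz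
    have hz2 : (z : CechMC1 g N T) ∈ cechMZ1 g N T := (mem_cechMZ1_iff g N T z).mpr hz1
    obtain ⟨b, hb⟩ := (mem_cechMB1_iff g N T _).mp (h hz2)
    exact (mem_cechMB1_iff f N T z).mpr ⟨b, hb⟩

omit φ in
/-- `Ȟ¹(𝒯; M) = 0` iff every Čech `1`-cocycle is a `1`-coboundary.
[cite: Hartshorne1977, III Thm. 4.5 p. 222] -/
theorem subsingleton_cechMH1_iff_cechMZ1_le_cechMB1 (N : Y.Modules) :
    Subsingleton (CechMH1 f N T) ↔ cechMZ1 f N T ≤ cechMB1 f N T := by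
  constructor
  · intro h c hc
    exact (CechMH1.mk_eq_zero_iff f N T ⟨c, hc⟩).mp (Subsingleton.elim _ _)
  · intro h
    refine ⟨fun x y => ?_⟩
    obtain ⟨z, rfl⟩ := CechMH1.mk_surjective f N T x
    obtain ⟨z', rfl⟩ := CechMH1.mk_surjective f N T y
    rw [CechMH1.mk_eq_mk_iff]
    exact h (Submodule.sub_mem _ z.2 z'.2)

end CechTransfer

section OpenImmersion

variable {A B : Type u} [CommRing A] [CommRing B] {Z S' : Scheme.{u}} (φ : Z ⟶ S') [IsOpenImmersion φ]
  (f : S' ⟶ Spec (.of A)) (g : Z ⟶ Spec (.of B)) (N : S'.Modules)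

omit [CommRing A] [CommRing B] in
/-- **The unit `N ⟶ φ_*(N|_Z)` of an open immersion is bijective on sections over opens inside the image**
(there it is the restriction map of `N` along `φ(φ⁻¹W) = W`).
[cite: StacksProject, Tag 01ED (Cohomology, Section 20.9)] [cite: GortzWedhorn2023, Lemma 21.65 (p. 259)] -/
theorem restrictAdjunction_unit_app_bijective {W : S'.Opens} (hW : W ≤ φ.opensRange) :
    Function.Bijective (((Scheme.Modules.restrictAdjunction φ).unit.app N).app W) := by
  have e : φ ''ᵁ φ ⁻¹ᵁ W = W := by
    rw [Scheme.Hom.image_preimage_eq_opensRange_inf, inf_eq_right.mpr hW]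
  rw [Scheme.Modules.restrictAdjunction_unit_app_app]
  -- restriction along `φ(φ⁻¹W) = W` has the restriction along the reverse inequality as inverse
  have hcomp₁ : homOfLE e.symm.le ≫ homOfLE (φ.image_preimage_le W) = 𝟙 _ := Subsingleton.elim _ _
  have hcomp₂ : homOfLE (φ.image_preimage_le W) ≫ homOfLE e.symm.le = 𝟙 _ := Subsingleton.elim _ _
  refine Function.bijective_iff_has_inverse.mpr ⟨N.presheaf.map (homOfLE e.symm.le).op, fun x => ?_, fun y => ?_⟩
  · change (N.presheaf.map (homOfLE (φ.image_preimage_le W)).op ≫ N.presheaf.map (homOfLE e.symm.le).op) x = x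
    rw [← N.presheaf.map_comp, ← op_comp, hcomp₁, op_id, N.presheaf.map_id]
    rfl
  · change (N.presheaf.map (homOfLE e.symm.le).op ≫ N.presheaf.map (homOfLE (φ.image_preimage_le W)).op) y = y
    rw [← N.presheaf.map_comp, ← op_comp, hcomp₂, op_id, N.presheaf.map_id]
    rfl


/-- **Čech `H¹` transport along an open immersion, degree one.** For an open immersion `φ : Z ⟶ S′`, an
`𝒪_{S′}`-module `N` and a family `𝒯 = (T_t)_t` of opens of `Z`: if every Čech `1`-cocycle of `N|_Z`
(Mathlib `N.restrict φ`, sections `Γ(φ T, N)`) on `𝒯` is a coboundary — for some structure map `g : Z → Spec B`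
— then every Čech `1`-cocycle of `N` on `(φ T_t)_t` is a coboundary, for any structure map `f : S′ → Spec A`
(change of structure map, `φ⁻¹(φ𝒯) = 𝒯`, `Č(φ𝒯; φ_*(N|_Z)) = Č(𝒯; N|_Z)`, and the unit `N ⟶ φ_*(N|_Z)`,
bijective over the `φ T_t` and their intersections).
[cite: StacksProject, Tag 01ED (Cohomology, Section 20.9)] [cite: Hartshorne1977, III Lemma 4.4 p. 220] -/
theorem cechMZ1_le_cechMB1_image_of_restrict {κ : Type*} (T : κ → Z.Opens)
    (h : cechMZ1 g (N.restrict φ) T ≤ cechMB1 g (N.restrict φ) T) :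
    cechMZ1 f N (fun t => φ ''ᵁ T t) ≤ cechMB1 f N (fun t => φ ''ᵁ T t) := by
  have h4 : cechMZ1 (φ ≫ f) (N.restrict φ) T ≤ cechMB1 (φ ≫ f) (N.restrict φ) T :=
    (cechMZ1_le_cechMB1_iff_of_structureMap g T (φ ≫ f) (N.restrict φ)).mp h
  have hpre : preimageFamily φ (fun t => φ ''ᵁ T t) = T := funext fun t => φ.preimage_image_eq _
  have h4' : cechMZ1 (φ ≫ f) (N.restrict φ) (preimageFamily φ fun t => φ ''ᵁ T t) ≤
      cechMB1 (φ ≫ f) (N.restrict φ) (preimageFamily φ fun t => φ ''ᵁ T t) := by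
    rw [hpre]
    exact h4
  have h5 : cechMZ1 f ((Scheme.Modules.pushforward φ).obj (N.restrict φ)) (fun t => φ ''ᵁ T t) ≤
      cechMB1 f ((Scheme.Modules.pushforward φ).obj (N.restrict φ)) (fun t => φ ''ᵁ T t) := by
    intro z hz
    have hz' := (mem_cechMZ1_pushforwardEquiv_iff f (fun t => φ ''ᵁ T t) (φ ≫ f) φ rfl
      (N.restrict φ) z).mpr hz
    exact (mem_cechMB1_pushforwardEquiv_iff f (fun t => φ ''ᵁ T t) (φ ≫ f) φ rfl
      (N.restrict φ) z).mp (h4' hz')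
  have hle : ∀ t, φ ''ᵁ T t ≤ φ.opensRange := fun t => by
    rw [← Scheme.Hom.image_top_eq_opensRange]
    exact φ.image_mono le_top
  exact cechMZ1_le_cechMB1_of_app_bijective f ((Scheme.Modules.restrictAdjunction φ).unit.app N)
    (fun t => φ ''ᵁ T t) (fun t => restrictAdjunction_unit_app_bijective φ N (hle t))
    (fun t t' => (restrictAdjunction_unit_app_bijective φ N ((inf_le_left).trans (hle t))).1) h5

/-- **Čech `H¹` transport along an open immersion, degree one, `Ȟ¹ = 0` form**: if
`Ȟ¹(𝒯; N|_Z) = 0` (any structure map `Z → Spec B`), then every Čech `1`-cocycle of `N` on `(φ T_t)_t` is a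
coboundary (any structure map `S′ → Spec A`).
[cite: StacksProject, Tag 01ED (Cohomology, Section 20.9)] [cite: Hartshorne1977, III Lemma 4.4 p. 220] -/
theorem cechMZ1_le_cechMB1_image_of_subsingleton_restrict {κ : Type*} (T : κ → Z.Opens)
    (h : Subsingleton (CechMH1 g (N.restrict φ) T)) :
    cechMZ1 f N (fun t => φ ''ᵁ T t) ≤ cechMB1 f N (fun t => φ ''ᵁ T t) :=
  cechMZ1_le_cechMB1_image_of_restrict φ f g N T
    ((subsingleton_cechMH1_iff_cechMZ1_le_cechMB1 g T (N.restrict φ)).mp h)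

end OpenImmersion

end Literature.AlgebraicGeometry.Morphisms

end
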